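import Literature.NumberTheory.Automorphic.AutomorphicTwistHecke
import Literature.NumberTheory.Automorphic.AsaiSignArchParityTwist
import Literature.NumberTheory.Automorphic.AsaiSign
import HarnessLib

/-!
# Quadratic descent for `GL₂`, line `Sketch` — stub W3: the twist of an Asai datum

Helper file for the crux `ParityBlindBianchi.QuadraticDescentGL2` (stmt-Langlands-16811), line
`Sketch`, stub `stub_twistAsaiDatum`.

For a cuspidal `P` on `GL₂(𝔸_E)` with Asai datum `(S, A)` and a Hecke character `μ` of `E`
unramified above the complement of `S`, the twist `P' = P ⊗ (μ ∘ det)`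
(`exists_cuspidalAutomorphicRepData_twist_hecke`, Borel–Jacquet 1979, 4.6 and 5.7) is cuspidal with
Asai datum `(S, μ(ϖ) • A)` (`AutomorphicRepData.HasSatakeParamAt.heckeTwist`:
`t_{P ⊗ μ, w} = μ(ϖ_w) t_{P, w}` wherever `μ` is unramified, Arthur–Clozel 1989, Ch. 3, proof of
Thm. 3.1, p. 172), and conversely the Satake parameters of `P'` at the unramified places of `μ`
untwist to those of `P` (`AutomorphicRepData.HasSatakeParamAt.of_heckeTwist`). The inertness
clause of an Asai datum does not mention the representation, so it is inherited verbatim.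

All inputs are theorems of the tree (`AutomorphicTwistHecke`, `AsaiSignArchParityTwist`,
`AsaiSign`).
-/

set_option linter.dupNamespace false

namespace Summit.Langlands.Langlands.Theorems.QuadraticDescentGL2.Sketch

open scoped Classical
open NumberField IsDedekindDomain Filter
open Literature.NumberTheory.Automorphic Literature.NumberTheory.GaloisRepresentations

/-- **Stub W3 (the twist of an Asai datum).** For a cuspidal `P` on `GL₂(𝔸_E)` with Asai datum
`(S, A)` and a Hecke character `μ` of `E` unramified above the complement of `S`, the twist
`P' = P ⊗ (μ ∘ det)` (`exists_cuspidalAutomorphicRepData_twist_hecke`) is cuspidal with Asai datum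
`(S, μ(ϖ) • A)` (`HasSatakeParamAt.heckeTwist`: `t_{P ⊗ μ, w} = μ(ϖ_w) t_{P, w}`), and conversely
its Satake parameters at the unramified places of `μ` untwist to those of `P`
(`HasSatakeParamAt.of_heckeTwist`). The hypotheses `[E : F] = 2` and `c ≠ 1` are not used.
[cite: ArthurClozelAMS120, Ch. 3, proof of Thm. 3.1 (p. 172)] -/
theorem stub_twistAsaiDatum :
    ∀ (F E : Type) [Field F] [NumberField F] [Field E] [NumberField E] [Algebra F E] (c : E ≃ₐ[F] E),
      Module.finrank F E = 2 → c ≠ 1 →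
      ∀ (hE : isCompact_glFiniteIntegralLevel 2 E) (P : CuspidalAutomorphicRepData 2 E hE)
        (μ : HeckeCharacter E) (S : Set (HeightOneSpectrum (𝓞 F))) (A : SatakeFamily E),
        P.1.IsAsaiDatum c S A →
        (∀ w : HeightOneSpectrum (𝓞 E), w.under (𝓞 F) ∉ S → μ.IsUnramifiedAt w) →
        ∃ P' : CuspidalAutomorphicRepData 2 E hE,
          P'.1.IsAsaiDatum c S (fun w => (A w).map (μ.valueAtUniformizer w * ·)) ∧
          ∀ (w : HeightOneSpectrum (𝓞 E)) (α : Multiset ℂ), P'.1.HasSatakeParamAt w α →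
            μ.IsUnramifiedAt w → P.1.HasSatakeParamAt w (α.map ((μ.valueAtUniformizer w)⁻¹ * ·)) := by
  intro F E _ _ _ _ _ c _h2 _hc hE P μ S A hSA hunr
  obtain ⟨P', hW, hW'⟩ := exists_cuspidalAutomorphicRepData_twist_hecke μ P
  exact ⟨P', ⟨hSA.finite, fun w hw => (hSA.hasSatakeParamAt hw).heckeTwist μ (hunr w hw) hW hW',
    fun w hw hcw => hSA.inertiaDeg_eq_two hw hcw⟩, fun w α hα hw => hα.of_heckeTwist μ hw hW hW'⟩

end Summit.Langlands.Langlands.Theorems.QuadraticDescentGL2.Sketch
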